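import Summits.HodgeConjecture.HodgeConjecture.Theses.NikulinTwinTransport
import Summits.HodgeConjecture.HodgeConjecture.Theorems.NikulinSerreCarrier.Negative.InvariantCarrierPinned
import Summits.HodgeConjecture.HodgeConjecture.Theorems.NikulinTwinTransportNikulinSerreCarrierMixedClassTransfer
import Literature.AlgebraicGeometry.Surfaces.K3Surface
import Literature.AlgebraicGeometry.Surfaces.K3NikulinInvolution
import Literature.AlgebraicGeometry.HodgeTheory.AnalytifiedVectorBundle
import Literature.AlgebraicGeometry.HodgeTheory.KaehlerClassHodgeType
import Literature.AlgebraicGeometry.HodgeTheory.ChernCharacterBetti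
import Literature.Geometry.Hyperkaehler.Hyperholomorphic

/-!
# Line `modular-twin-address` — crux `NikulinSerreCarrier` (stmt-HodgeConjecture-14464, K1), route NikulinTwinTransport

Crux-plan skeleton (planner-cruxplan-stmt-HodgeConjecture-14464-modular-twin-address-0, 2026-08-16) for the
idea `modular-twin-address` (crux-ideate r1, ideator 2; triage r1: pass ×3).  Companion card:
`Lines/modular-twin-address.md`.

SKELETON v3 (second line lead prover-line-stmt-HodgeConjecture-14464-b-0, 2026-08-16) — RESHAPED after the standing
disprover's gen-3 §L formal kill of v2 (`Negative/OrientationTwist`, `Negative/TypedCruxFalse`,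
`Negative/StubModularTwinAddressFalse`; notes `StubNoteModularTwinAddress.md`, `StubNoteMixedClassTransfer.md`):
every clause `∀ μ : OrientationFamily … ∃ m : ℤ, m ≠ 0 ∧ f_*^μ(…) = (−m) • …` is false at `μ = twistFamily` (Gysin
maps rescale by `I` with the orientation family; rational classes are real).  The disprover's minimal repair C′ is
adopted symbol for symbol: `m : ℂ` (i) in the carrier clause of the typed crux `NikulinSerreCarrier` below (v3 of the
transcription; same FQ name, the v2 body differs in this one token), (ii) in the address equation of
`stub_modularTwinAddress`, (iii) in hypothesis AND conclusion of `stub_mixedClassTransfer`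
(`Negative/OrientationTwist.exists_ne_zero_smul_of_orientationFamily`: such clauses transfer between orientation
families, and they are invariant under the rescalings `chᵢ ↦ λⁱ chᵢ` that `ChernCharacterBetti` does not exclude).
Second change: `stub_mixedClassTransfer` now CARRIES the Künneth spanning property of `H*((Y′ ⊗ Z′)(ℂ); ℂ)` as a
hypothesis (verbatim the `hK` of `Literature.AlgebraicGeometry.HodgeTheory.gysin_baseChange_of_kunneth`, under which the
tree proves every Gysin base change), supplied to the composition by the new registered stub `stub_kunnethSpanning`
(formal debt, Hatcher Thm 3.15/3.16) — four stubs, `NikulinSerreCarrier_of` recomposes.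

SKELETON v4 (same lead, after wave 1): `stub_mixedClassTransfer` LANDED (p81390, worker of this lead; file
`Theorems/NikulinTwinTransportNikulinSerreCarrierMixedClassTransfer.lean`, with reusable helpers
`gysin_baseChange_whiskerLeft_of_kunneth`, `cupPairing_gysin_fst_eq_cupPairing_gysin_snd`, …) and is now IMPORTED and
used inside `NikulinSerreCarrier_of`; `stub_trianalyticRestriction` came back `stub-blocked` on infrastructure
(Hodge-model / analytified-bundle restriction along `X ◁ g`, Calabi–Yau product splitting) with the one cleanly
typable named fact LANDED as `Literature.Geometry.Hyperkaehler.Verbitsky1995_isTrianalytic_of_cupMatrix` (p83665);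
three registered stubs remain: `stub_modularTwinAddress` (research), `stub_trianalyticRestriction` (theorem, blocked on
infrastructure), `stub_kunnethSpanning` (formal debt).

THE CRUX DECL.  The route item is informal (no Lean signature), so this skeleton concludes the planner's
typed transcription `Summit.HodgeConjecture.HodgeConjecture.Cruxes.NikulinSerreCarrier.NikulinSerreCarrier`
(published as the work-file `Cruxes/NikulinSerreCarrier/TypedCrux.lean`, whose module docstring explains the
reading clause by clause, and INLINED VERBATIM below — crux work-files are not built into importable modules on
the farm (`remote:stale:unbuilt`), so the definition travels with each line file; the two copies are textually
identical, generated from one source); audit with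
`ledger skeleton check <this file> --crux stmt-HodgeConjecture-14464 --crux-decl Summit.HodgeConjecture.HodgeConjecture.Cruxes.NikulinSerreCarrier.NikulinSerreCarrier`.

THE LINE (E3 made two-sided, (←) direction).  A carrier on `X × Y′` is the same thing as a trianalytic
copy of the twin `Y′` inside a hyperholomorphic modular family over `X`; so CONSTRUCT it that way:
* `stub_modularTwinAddress` (XL, the research heart): a smooth projective `Mv` ("= `M_ω(v)`", a moduli
  space of `ω`-stable bundles on `X` with Mukai vector `v`, `ι^*v ≠ v` allowed), a vector bundle `𝓔` on
  `X ⊗ Mv` ("= `End₀` of the (twisted) universal family") hyperholomorphic for a PRODUCT hyperkähler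
  structure with `X`-Kähler class `ω = Ψ ω′` (sub-lemma K-a: the tautological connection is
  hyperholomorphic for `g_X × g_{L²}`; Itoh, Mukai, BBHR for `dim = 2`), and a closed immersion
  `g : Y′ ↪ Mv` — THE ADDRESS — with (a) `SU(2)`-invariant class: the cup matrix of the three restricted
  hyperkähler classes `g^*κ_I, g^*κ_J, g^*κ_K` is `c·𝟙`, `c > 0`; (b) frame: `g^*κ_I = ω′`; (c) address
  equation `g^* ∘ θ ∘ Ψ = −2m` on `H²(Y′)`, `θ x = snd_*(fst^* x ∪ ch₂ 𝓔)` Mukai's map, `m ∈ ℂ ∖ 0` (v3);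
  (d) `ch₁` of the restriction vanishes.  (Design rules from the panel: `g(Y′)` is NOT a component of
  `Fix(ι^M)` — those are route-dead by FRAME PINNING / confinement (triage r1-1/2/3,
  `Theorems/NikulinSerreCarrier/Negative/InvariantCarrierPinned`) and indeed (c) with `Ψ Nⱼ = rⱼ ∈ E₈(−2)`
  forces the mixed class to see `E₈(−2)`; the `v² = 2` (`K3^{[2]}`-type) sector is empty by the card's
  census (conic `575a²−100ab+12b²−690a+60b+24 = 0` has no rational point, re-checked by two triagers);
  admissible slice vectors have `c₁ = 0`, `r ≥ 2`, `s ≤ −r` (Disproof §E), hence `𝓔 = End₀(…)`.)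
* `stub_trianalyticRestriction` (L): Verbitsky's criterion — a compact complex surface in a hyperkähler
  manifold whose class is `SU(2)`-invariant (numerically: (a)) is trianalytic — and the restriction of a
  hyperholomorphic bundle to the trianalytic `X × g(Y′)` is hyperholomorphic for the induced product
  structure, whose Kähler class is `ω ⊞ g^*κ_I`: the analytic package of K1 on `X ⊗ Y′`.
* `stub_mixedClassTransfer` (M): Gysin base change / projection formula / Künneth + the similitude algebra
  `ΨᵗΨ = 2`: the address equation (c) gives `[ch₂((X ◁ g)^*𝓔)]_* = −m′·Ψ` on `H²(Y′)`, `m′ = ±m ≠ 0`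
  (the "class computation P₋ ≠ 0" the triage asked to see first).
* `NikulinSerreCarrier_of`: logic (instantiate, rewrite (b), assemble).

DISPROOF USED.  No `_false_without_` theorem exists (the crux is informal; Disproof.lean gen-2 certifies
cores only).  Honoured: §A/K1-integrality (Ψ rational, `m` even — `m` is produced by the address stub as an
integer, no parity claimed), §B (no isotropic slice / FM-partner shortcut: `Mv` is a genuine higher-dimensional
family, `k` free), §C sign law (not contradicted: `m`'s sign is free), §D/§E (`c₁ = 0` carriers, slices of
rank ≥ 2: `𝓔 = End₀`), FRAME PINNING / confinement (the frame keeps `εⱼ > 0`; (c) makes the mixed class act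
through `Ψ`, which does not kill `E₈(−2)`), gen-1 E1/E2 (no Serre bundle, no elementary transformation).
No stub is an instance of a landed Negative lemma: `InvariantCarrierPinned` refutes carriers KILLING `E₈(−2)`,
excluded here by (c).
-/

open scoped Manifold ContDiff
open CategoryTheory MonoidalCategory
open Literature.AlgebraicGeometry Literature.AlgebraicGeometry.HodgeTheory
open Literature.AlgebraicGeometry.Surfaces Literature.AlgebraicGeometry.Motives
open Literature.AlgebraicTopology.SingularHomology
open Literature.Geometry.Hyperkaehler Literature.Geometry.Kaehler
open Literature.NumberTheory.Transcendental (DeRhamIsoFamily)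

namespace Summit.HodgeConjecture.HodgeConjecture.Cruxes.NikulinSerreCarrier

/-- **K1, typed (K1∃, existential anchor).**  There is a Nikulin anchor `(X, ι, Y, N, h, r, Ψ)` as in the
module docstring, with `Ψ` algebraic at the anchor, a frame `εⱼ > 0`, `ω′ = h − Σ εⱼNⱼ`, `ω = Ψ ω′`, and an
algebraic vector bundle `G` on `X ⊗ Y` with `ch₁(G) = 0`, `[ch₂(G)]_* = −m·Ψ` (`m ∈ ℂ ∖ 0`; v3 = repair C′ of the
disprover's §L — the true `m` is an even positive integer for the complex orientation and the standard Chern character,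
invisible on this carrier) whose
analytification admits a hyperholomorphic Chern connection for a hyperkähler structure on `(X ⊗ Y)^an` with
Kähler class `ω ⊞ ω′`. -/
def NikulinSerreCarrier : Prop :=
  ∀ (μ : OrientationFamily), μ.HasPoincareDuality → ∀ (C : ChernCharacterBetti),
    ∃ (X Y : SchemeOver ℂ) (hX : IsK3Surface X) (hY : IsK3Surface Y)
      (pX : complexBetti X (2 * 2)) (pY : complexBetti Y (2 * 2)) (ι : X ⟶ X)
      (N : Fin 8 → complexBetti Y (2 * 1)) (h : complexBetti Y (2 * 1)) (r : Fin 8 → complexBetti X (2 * 1))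
      (Ψ : complexBetti Y (2 * 1) →ₗ[ℂ] complexBetti X (2 * 1)),
      -- X carries the Nikulin involution ι; pX, pY are integral generators of H⁴
      IsNikulinInvolution X ι ∧
      (IsIntegralClass pX ∧ ∀ q : complexBetti X (2 * 2), IsIntegralClass q → ∃ n : ℤ, q = n • pX) ∧
      (IsIntegralClass pY ∧ ∀ q : complexBetti Y (2 * 2), IsIntegralClass q → ∃ n : ℤ, q = n • pY) ∧
      -- the eight nodal classes and the even eight
      (∀ j, IsIntegralClass (N j) ∧ N j ∈ algebraicClasses Y 1) ∧
      (∀ i j, cupProduct (rfl : 2 * 1 + 2 * 1 = 2 * 2) (N i) (N j) =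
        (if i = j then (-2 : ℂ) else 0) • pY) ∧
      IsIntegralClass ((1 / 2 : ℂ) • ∑ j, N j) ∧
      -- the class h (pull-back of an ample class of X/ι): integral, algebraic, h ⊥ Nⱼ, h² = 2d > 0
      (IsIntegralClass h ∧ h ∈ algebraicClasses Y 1) ∧
      (∀ j, cupProduct (rfl : 2 * 1 + 2 * 1 = 2 * 2) h (N j) = 0) ∧
      (∃ d : ℕ, 0 < d ∧ cupProduct (rfl : 2 * 1 + 2 * 1 = 2 * 2) h h = ((2 * d : ℕ) : ℂ) • pY) ∧
      -- the eight roots rⱼ of E₈(−2) ⊂ NS(X): integral, algebraic, ι-anti-invariant, (rᵢ.rⱼ) = −4δᵢⱼ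
      (∀ j, IsIntegralClass (r j) ∧ r j ∈ algebraicClasses X 1 ∧
        complexBetti.map ι (2 * 1) (r j) = -r j) ∧
      (∀ i j, cupProduct (rfl : 2 * 1 + 2 * 1 = 2 * 2) (r i) (r j) =
        (if i = j then (-4 : ℂ) else 0) • pX) ∧
      -- the completed Nikulin 2-similitude Ψ: rational, type-preserving, (Ψx.Ψy) = 2(x.y), bijective,
      -- Ψ Nⱼ = rⱼ, ι^*-invariant on N^⊥ (= g^* there)
      (∀ x, IsRationalClass x → IsRationalClass (Ψ x)) ∧
      (∀ (i j : ℕ) (x : complexBetti Y (2 * 1)),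
        IsOfHodgeType 2 Y (2 * 1) i j x → IsOfHodgeType 2 X (2 * 1) i j (Ψ x)) ∧
      (∀ (x y : complexBetti Y (2 * 1)) (a : ℂ),
        cupProduct (rfl : 2 * 1 + 2 * 1 = 2 * 2) x y = a • pY →
        cupProduct (rfl : 2 * 1 + 2 * 1 = 2 * 2) (Ψ x) (Ψ y) = ((2 : ℂ) * a) • pX) ∧
      Function.Bijective Ψ ∧
      (∀ j, Ψ (N j) = r j) ∧
      (∀ x : complexBetti Y (2 * 1), (∀ j, cupProduct (rfl : 2 * 1 + 2 * 1 = 2 * 2) x (N j) = 0) →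
        complexBetti.map ι (2 * 1) (Ψ x) = Ψ x) ∧
      -- ALGEBRAIC AT THE ANCHOR: Ψ = [γ₀]_* for an algebraic class γ₀ on X ⊗ Y
      (∃ γ₀ ∈ algebraicClasses (X ⊗ Y) 2, ∀ x : complexBetti Y (2 * 1),
        Ψ x = complexGysin μ (IsSmoothProjective.tensor_holds hX.1 hY.1) hX.1
          (SemiCartesianMonoidalCategory.fst X Y)
          (rfl : 2 * 1 + 2 * 2 + 2 * 2 = 2 * 1 + 2 * (2 + 2))
          (cupProduct (rfl : 2 * 1 + 2 * 2 = 2 * 1 + 2 * 2)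
            (complexBetti.map (SemiCartesianMonoidalCategory.snd X Y) (2 * 1) x) γ₀)) ∧
      ∃ ε : Fin 8 → ℝ, (∀ j, 0 < ε j) ∧
      ∃ ω' : complexBetti Y (2 * 1), ω' = h - ∑ j, ((ε j : ℝ) : ℂ) • N j ∧
      ∃ (G : (X ⊗ Y).left.Modules) (rk : ℕ), IsVectorBundle G ∧ C.ch (X ⊗ Y) G 1 = 0 ∧
        (∃ m : ℂ, m ≠ 0 ∧ ∀ y : complexBetti Y (2 * 1),
          complexGysin μ (IsSmoothProjective.tensor_holds hX.1 hY.1) hX.1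
            (SemiCartesianMonoidalCategory.fst X Y)
            (rfl : 2 * 1 + 2 * 2 + 2 * 2 = 2 * 1 + 2 * (2 + 2))
            (cupProduct (rfl : 2 * 1 + 2 * 2 = 2 * 1 + 2 * 2)
              (complexBetti.map (SemiCartesianMonoidalCategory.snd X Y) (2 * 1) y)
              (C.ch (X ⊗ Y) G 2)) =
          (-m) • Ψ y) ∧
        ∃ (A : HodgeModel (2 + 2) (X ⊗ Y))
          (𝓕 : AnalytifiedVectorBundle 𝓘(ℂ, A.model) (EuclideanSpace ℂ (Fin rk)) A.toComplexPoints
            G)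
          (gm : Bundle.ContMDiffRiemannianMetric 𝓘(ℝ, A.model) ∞ A.model
            (fun x : A.carrier ↦ TangentSpace 𝓘(ℝ, A.model) x))
          (J K : ∀ x : A.carrier, TangentSpace 𝓘(ℝ, A.model) x →L[ℝ] TangentSpace 𝓘(ℝ, A.model) x)
          (hHK : IsHyperkaehlerTriple gm.toRiemannianMetric J K)
          (hω : isSmoothForm_kaehlerForm_of_isManifold_complex (E := A.model) (M := A.carrier))
          (e : DeRhamIsoFamily 𝓘(ℝ, A.model)),
          e.IsNatural ∧
          A.pullback 2
              (complexBetti.map (SemiCartesianMonoidalCategory.fst X Y) (2 * 1) (Ψ ω') +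
                complexBetti.map (SemiCartesianMonoidalCategory.snd X Y) (2 * 1) (ω')) =
            ofRealClass A.carrier 2 (e A.carrier 2 (gm.kaehlerClass hω hHK.isKaehler)) ∧
          HasHyperholomorphicConnection (EuclideanSpace ℂ (Fin rk)) 𝓕.bundle J K

end Summit.HodgeConjecture.HodgeConjecture.Cruxes.NikulinSerreCarrier

namespace Summit.HodgeConjecture.HodgeConjecture.Cruxes.NikulinSerreCarrier.ModularTwinAddress

/-! ## The stubs (registered: `stub_*`, each `:= by sorry`; their statements are also named
`Statement.stub_*` so that `NikulinSerreCarrier_of` can take them as hypotheses BY NAME — the two spellings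
are certified identical by `rfl` below each stub; the audit admits the hypotheses of `_of` by the
short name `stub_*` of their head constant). -/

/-- **Address stub (XL — the hardest; sub-lemmas K-a, Mukai package, census, Torelli inside).**
There is a Nikulin anchor `(X, ι, Y, N, h, r, Ψ)` (conjuncts = those of the typed crux, verbatim) with a frame
`εⱼ > 0`, `ω′ = h − ΣεⱼNⱼ`, a smooth projective `Mv` with an algebraic vector bundle `𝓔` on `X ⊗ Mv` that is
hyperholomorphic for a product hyperkähler structure with `X`-Kähler class `Ψ ω′` (classes `Ψω′ ⊞ κ_I`,
`α_J ⊞ κ_J`, `α_K ⊞ κ_K`), and a closed immersion `g : Y ⟶ Mv` with invariant class (cup matrix `c·𝟙`,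
`c > 0`), frame `g^*κ_I = ω′`, `ch₁((X ◁ g)^*𝓔) = 0` and the address equation
`g^*(snd_*(fst^*(Ψ y) ∪ ch₂ 𝓔)) = −2m·y`, `m ∈ ℂ ∖ 0` (v3: `ℂ`, not `ℤ`).  Intended proof: `Mv = M_{Ψω′}(v)` (fine, compact,
all members locally free — choose `v` accordingly), `𝓔 = End₀(𝓤)`, `g_{Mv}` = Itoh–Mukai `L²` metric
(K-a), `θ_v` = Mukai's isometry, `g(Y)` = an algebraic twin surface found by the census + global Torelli.
[difficulty: XL] -/
def Statement.stub_modularTwinAddress : Prop :=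
  ∀ (μ : OrientationFamily), μ.HasPoincareDuality → ∀ (C : ChernCharacterBetti),
    ∃ (X Y : SchemeOver ℂ) (hX : IsK3Surface X) (hY : IsK3Surface Y)
      (pX : complexBetti X (2 * 2)) (pY : complexBetti Y (2 * 2)) (ι : X ⟶ X)
      (N : Fin 8 → complexBetti Y (2 * 1)) (h : complexBetti Y (2 * 1)) (r : Fin 8 → complexBetti X (2 * 1))
      (Ψ : complexBetti Y (2 * 1) →ₗ[ℂ] complexBetti X (2 * 1)),
      IsNikulinInvolution X ι ∧
      (IsIntegralClass pX ∧ ∀ q : complexBetti X (2 * 2), IsIntegralClass q → ∃ n : ℤ, q = n • pX) ∧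
      (IsIntegralClass pY ∧ ∀ q : complexBetti Y (2 * 2), IsIntegralClass q → ∃ n : ℤ, q = n • pY) ∧
      (∀ j, IsIntegralClass (N j) ∧ N j ∈ algebraicClasses Y 1) ∧
      (∀ i j, cupProduct (rfl : 2 * 1 + 2 * 1 = 2 * 2) (N i) (N j) =
        (if i = j then (-2 : ℂ) else 0) • pY) ∧
      IsIntegralClass ((1 / 2 : ℂ) • ∑ j, N j) ∧
      (IsIntegralClass h ∧ h ∈ algebraicClasses Y 1) ∧
      (∀ j, cupProduct (rfl : 2 * 1 + 2 * 1 = 2 * 2) h (N j) = 0) ∧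
      (∃ d : ℕ, 0 < d ∧ cupProduct (rfl : 2 * 1 + 2 * 1 = 2 * 2) h h = ((2 * d : ℕ) : ℂ) • pY) ∧
      (∀ j, IsIntegralClass (r j) ∧ r j ∈ algebraicClasses X 1 ∧
        complexBetti.map ι (2 * 1) (r j) = -r j) ∧
      (∀ i j, cupProduct (rfl : 2 * 1 + 2 * 1 = 2 * 2) (r i) (r j) =
        (if i = j then (-4 : ℂ) else 0) • pX) ∧
      (∀ x, IsRationalClass x → IsRationalClass (Ψ x)) ∧
      (∀ (i j : ℕ) (x : complexBetti Y (2 * 1)),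
        IsOfHodgeType 2 Y (2 * 1) i j x → IsOfHodgeType 2 X (2 * 1) i j (Ψ x)) ∧
      (∀ (x y : complexBetti Y (2 * 1)) (a : ℂ),
        cupProduct (rfl : 2 * 1 + 2 * 1 = 2 * 2) x y = a • pY →
        cupProduct (rfl : 2 * 1 + 2 * 1 = 2 * 2) (Ψ x) (Ψ y) = ((2 : ℂ) * a) • pX) ∧
      Function.Bijective Ψ ∧
      (∀ j, Ψ (N j) = r j) ∧
      (∀ x : complexBetti Y (2 * 1), (∀ j, cupProduct (rfl : 2 * 1 + 2 * 1 = 2 * 2) x (N j) = 0) →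
        complexBetti.map ι (2 * 1) (Ψ x) = Ψ x) ∧
      (∃ γ₀ ∈ algebraicClasses (X ⊗ Y) 2, ∀ x : complexBetti Y (2 * 1),
        Ψ x = complexGysin μ (IsSmoothProjective.tensor_holds hX.1 hY.1) hX.1
          (SemiCartesianMonoidalCategory.fst X Y)
          (rfl : 2 * 1 + 2 * 2 + 2 * 2 = 2 * 1 + 2 * (2 + 2))
          (cupProduct (rfl : 2 * 1 + 2 * 2 = 2 * 1 + 2 * 2)
            (complexBetti.map (SemiCartesianMonoidalCategory.snd X Y) (2 * 1) x) γ₀)) ∧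
      ∃ ε : Fin 8 → ℝ, (∀ j, 0 < ε j) ∧
      ∃ ω' : complexBetti Y (2 * 1), ω' = h - ∑ j, ((ε j : ℝ) : ℂ) • N j ∧
      ∃ (k : ℕ) (Mv : SchemeOver ℂ) (hMv : IsSmoothProjective k Mv) (𝓔 : (X ⊗ Mv).left.Modules)
        (rk : ℕ) (g : Y ⟶ Mv),
        IsVectorBundle 𝓔 ∧ AlgebraicGeometry.IsClosedImmersion g.left ∧
        (∃ (κI κJ κK : complexBetti Mv (2 * 1)) (αJ αK : complexBetti X (2 * 1)) (c : ℝ), 0 < c ∧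
          (∃ (A : HodgeModel (2 + k) (X ⊗ Mv))
            (𝓕 : AnalytifiedVectorBundle 𝓘(ℂ, A.model) (EuclideanSpace ℂ (Fin rk)) A.toComplexPoints 𝓔)
            (gm : Bundle.ContMDiffRiemannianMetric 𝓘(ℝ, A.model) ∞ A.model
              (fun x : A.carrier ↦ TangentSpace 𝓘(ℝ, A.model) x))
            (J K : ∀ x : A.carrier, TangentSpace 𝓘(ℝ, A.model) x →L[ℝ] TangentSpace 𝓘(ℝ, A.model) x)
            (hHK : IsHyperkaehlerTriple gm.toRiemannianMetric J K)
            (hω : isSmoothForm_kaehlerForm_of_isManifold_complex (E := A.model) (M := A.carrier))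
            (e : DeRhamIsoFamily 𝓘(ℝ, A.model)),
            e.IsNatural ∧
            A.pullback 2
                (complexBetti.map (SemiCartesianMonoidalCategory.fst X Mv) (2 * 1) (Ψ ω') +
                  complexBetti.map (SemiCartesianMonoidalCategory.snd X Mv) (2 * 1) κI) =
              ofRealClass A.carrier 2 (e A.carrier 2 (gm.kaehlerClass hω hHK.isKaehler)) ∧
            A.pullback 2
                (complexBetti.map (SemiCartesianMonoidalCategory.fst X Mv) (2 * 1) αJ +
                  complexBetti.map (SemiCartesianMonoidalCategory.snd X Mv) (2 * 1) κJ) =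
              ofRealClass A.carrier 2 (e A.carrier 2 (deRhamCohomology.mk
                ⟨twoFormOf gm.toRiemannianMetric J, hHK.isSmoothForm_J, hHK.isClosedForm_J⟩)) ∧
            A.pullback 2
                (complexBetti.map (SemiCartesianMonoidalCategory.fst X Mv) (2 * 1) αK +
                  complexBetti.map (SemiCartesianMonoidalCategory.snd X Mv) (2 * 1) κK) =
              ofRealClass A.carrier 2 (e A.carrier 2 (deRhamCohomology.mk
                ⟨twoFormOf gm.toRiemannianMetric K, hHK.isSmoothForm_K, hHK.isClosedForm_K⟩)) ∧
            HasHyperholomorphicConnection (EuclideanSpace ℂ (Fin rk)) 𝓕.bundle J K) ∧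
          (cupProduct (rfl : 2 * 1 + 2 * 1 = 2 * 2) (complexBetti.map g (2 * 1) κI) (complexBetti.map g (2 * 1) κI) = ((c : ℝ) : ℂ) • pY ∧
          cupProduct (rfl : 2 * 1 + 2 * 1 = 2 * 2) (complexBetti.map g (2 * 1) κJ) (complexBetti.map g (2 * 1) κJ) = ((c : ℝ) : ℂ) • pY ∧
          cupProduct (rfl : 2 * 1 + 2 * 1 = 2 * 2) (complexBetti.map g (2 * 1) κK) (complexBetti.map g (2 * 1) κK) = ((c : ℝ) : ℂ) • pY ∧
          cupProduct (rfl : 2 * 1 + 2 * 1 = 2 * 2) (complexBetti.map g (2 * 1) κI) (complexBetti.map g (2 * 1) κJ) = 0 ∧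
          cupProduct (rfl : 2 * 1 + 2 * 1 = 2 * 2) (complexBetti.map g (2 * 1) κI) (complexBetti.map g (2 * 1) κK) = 0 ∧
          cupProduct (rfl : 2 * 1 + 2 * 1 = 2 * 2) (complexBetti.map g (2 * 1) κJ) (complexBetti.map g (2 * 1) κK) = 0) ∧
          complexBetti.map g (2 * 1) κI = ω') ∧
        C.ch (X ⊗ Y) ((AlgebraicGeometry.Scheme.Modules.pullback (X ◁ g).left).obj 𝓔) 1 = 0 ∧
        (∃ m : ℂ, m ≠ 0 ∧ ∀ y : complexBetti Y (2 * 1),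
          complexBetti.map g (2 * 1)
            (complexGysin μ (IsSmoothProjective.tensor_holds hX.1 hMv) hMv
              (SemiCartesianMonoidalCategory.snd X Mv)
              (by omega : 2 * 3 + 2 * k = 2 * 1 + 2 * (2 + k))
              (cupProduct (rfl : 2 * 1 + 2 * 2 = 2 * 3)
                (complexBetti.map (SemiCartesianMonoidalCategory.fst X Mv) (2 * 1) (Ψ y))
                (C.ch (X ⊗ Mv) 𝓔 2))) =
          (-(2 * m)) • y)

theorem stub_modularTwinAddress :
    ∀ (μ : OrientationFamily), μ.HasPoincareDuality → ∀ (C : ChernCharacterBetti),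
      ∃ (X Y : SchemeOver ℂ) (hX : IsK3Surface X) (hY : IsK3Surface Y)
        (pX : complexBetti X (2 * 2)) (pY : complexBetti Y (2 * 2)) (ι : X ⟶ X)
        (N : Fin 8 → complexBetti Y (2 * 1)) (h : complexBetti Y (2 * 1)) (r : Fin 8 → complexBetti X (2 * 1))
        (Ψ : complexBetti Y (2 * 1) →ₗ[ℂ] complexBetti X (2 * 1)),
        IsNikulinInvolution X ι ∧
        (IsIntegralClass pX ∧ ∀ q : complexBetti X (2 * 2), IsIntegralClass q → ∃ n : ℤ, q = n • pX) ∧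
        (IsIntegralClass pY ∧ ∀ q : complexBetti Y (2 * 2), IsIntegralClass q → ∃ n : ℤ, q = n • pY) ∧
        (∀ j, IsIntegralClass (N j) ∧ N j ∈ algebraicClasses Y 1) ∧
        (∀ i j, cupProduct (rfl : 2 * 1 + 2 * 1 = 2 * 2) (N i) (N j) =
          (if i = j then (-2 : ℂ) else 0) • pY) ∧
        IsIntegralClass ((1 / 2 : ℂ) • ∑ j, N j) ∧
        (IsIntegralClass h ∧ h ∈ algebraicClasses Y 1) ∧
        (∀ j, cupProduct (rfl : 2 * 1 + 2 * 1 = 2 * 2) h (N j) = 0) ∧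
        (∃ d : ℕ, 0 < d ∧ cupProduct (rfl : 2 * 1 + 2 * 1 = 2 * 2) h h = ((2 * d : ℕ) : ℂ) • pY) ∧
        (∀ j, IsIntegralClass (r j) ∧ r j ∈ algebraicClasses X 1 ∧
          complexBetti.map ι (2 * 1) (r j) = -r j) ∧
        (∀ i j, cupProduct (rfl : 2 * 1 + 2 * 1 = 2 * 2) (r i) (r j) =
          (if i = j then (-4 : ℂ) else 0) • pX) ∧
        (∀ x, IsRationalClass x → IsRationalClass (Ψ x)) ∧
        (∀ (i j : ℕ) (x : complexBetti Y (2 * 1)),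
          IsOfHodgeType 2 Y (2 * 1) i j x → IsOfHodgeType 2 X (2 * 1) i j (Ψ x)) ∧
        (∀ (x y : complexBetti Y (2 * 1)) (a : ℂ),
          cupProduct (rfl : 2 * 1 + 2 * 1 = 2 * 2) x y = a • pY →
          cupProduct (rfl : 2 * 1 + 2 * 1 = 2 * 2) (Ψ x) (Ψ y) = ((2 : ℂ) * a) • pX) ∧
        Function.Bijective Ψ ∧
        (∀ j, Ψ (N j) = r j) ∧
        (∀ x : complexBetti Y (2 * 1), (∀ j, cupProduct (rfl : 2 * 1 + 2 * 1 = 2 * 2) x (N j) = 0) →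
          complexBetti.map ι (2 * 1) (Ψ x) = Ψ x) ∧
        (∃ γ₀ ∈ algebraicClasses (X ⊗ Y) 2, ∀ x : complexBetti Y (2 * 1),
          Ψ x = complexGysin μ (IsSmoothProjective.tensor_holds hX.1 hY.1) hX.1
            (SemiCartesianMonoidalCategory.fst X Y)
            (rfl : 2 * 1 + 2 * 2 + 2 * 2 = 2 * 1 + 2 * (2 + 2))
            (cupProduct (rfl : 2 * 1 + 2 * 2 = 2 * 1 + 2 * 2)
              (complexBetti.map (SemiCartesianMonoidalCategory.snd X Y) (2 * 1) x) γ₀)) ∧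
        ∃ ε : Fin 8 → ℝ, (∀ j, 0 < ε j) ∧
        ∃ ω' : complexBetti Y (2 * 1), ω' = h - ∑ j, ((ε j : ℝ) : ℂ) • N j ∧
        ∃ (k : ℕ) (Mv : SchemeOver ℂ) (hMv : IsSmoothProjective k Mv) (𝓔 : (X ⊗ Mv).left.Modules)
          (rk : ℕ) (g : Y ⟶ Mv),
          IsVectorBundle 𝓔 ∧ AlgebraicGeometry.IsClosedImmersion g.left ∧
          (∃ (κI κJ κK : complexBetti Mv (2 * 1)) (αJ αK : complexBetti X (2 * 1)) (c : ℝ), 0 < c ∧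
            (∃ (A : HodgeModel (2 + k) (X ⊗ Mv))
              (𝓕 : AnalytifiedVectorBundle 𝓘(ℂ, A.model) (EuclideanSpace ℂ (Fin rk)) A.toComplexPoints 𝓔)
              (gm : Bundle.ContMDiffRiemannianMetric 𝓘(ℝ, A.model) ∞ A.model
                (fun x : A.carrier ↦ TangentSpace 𝓘(ℝ, A.model) x))
              (J K : ∀ x : A.carrier, TangentSpace 𝓘(ℝ, A.model) x →L[ℝ] TangentSpace 𝓘(ℝ, A.model) x)
              (hHK : IsHyperkaehlerTriple gm.toRiemannianMetric J K)
              (hω : isSmoothForm_kaehlerForm_of_isManifold_complex (E := A.model) (M := A.carrier))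
              (e : DeRhamIsoFamily 𝓘(ℝ, A.model)),
              e.IsNatural ∧
              A.pullback 2
                  (complexBetti.map (SemiCartesianMonoidalCategory.fst X Mv) (2 * 1) (Ψ ω') +
                    complexBetti.map (SemiCartesianMonoidalCategory.snd X Mv) (2 * 1) κI) =
                ofRealClass A.carrier 2 (e A.carrier 2 (gm.kaehlerClass hω hHK.isKaehler)) ∧
              A.pullback 2
                  (complexBetti.map (SemiCartesianMonoidalCategory.fst X Mv) (2 * 1) αJ +
                    complexBetti.map (SemiCartesianMonoidalCategory.snd X Mv) (2 * 1) κJ) =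
                ofRealClass A.carrier 2 (e A.carrier 2 (deRhamCohomology.mk
                  ⟨twoFormOf gm.toRiemannianMetric J, hHK.isSmoothForm_J, hHK.isClosedForm_J⟩)) ∧
              A.pullback 2
                  (complexBetti.map (SemiCartesianMonoidalCategory.fst X Mv) (2 * 1) αK +
                    complexBetti.map (SemiCartesianMonoidalCategory.snd X Mv) (2 * 1) κK) =
                ofRealClass A.carrier 2 (e A.carrier 2 (deRhamCohomology.mk
                  ⟨twoFormOf gm.toRiemannianMetric K, hHK.isSmoothForm_K, hHK.isClosedForm_K⟩)) ∧
              HasHyperholomorphicConnection (EuclideanSpace ℂ (Fin rk)) 𝓕.bundle J K) ∧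
            (cupProduct (rfl : 2 * 1 + 2 * 1 = 2 * 2) (complexBetti.map g (2 * 1) κI) (complexBetti.map g (2 * 1) κI) = ((c : ℝ) : ℂ) • pY ∧
            cupProduct (rfl : 2 * 1 + 2 * 1 = 2 * 2) (complexBetti.map g (2 * 1) κJ) (complexBetti.map g (2 * 1) κJ) = ((c : ℝ) : ℂ) • pY ∧
            cupProduct (rfl : 2 * 1 + 2 * 1 = 2 * 2) (complexBetti.map g (2 * 1) κK) (complexBetti.map g (2 * 1) κK) = ((c : ℝ) : ℂ) • pY ∧
            cupProduct (rfl : 2 * 1 + 2 * 1 = 2 * 2) (complexBetti.map g (2 * 1) κI) (complexBetti.map g (2 * 1) κJ) = 0 ∧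
            cupProduct (rfl : 2 * 1 + 2 * 1 = 2 * 2) (complexBetti.map g (2 * 1) κI) (complexBetti.map g (2 * 1) κK) = 0 ∧
            cupProduct (rfl : 2 * 1 + 2 * 1 = 2 * 2) (complexBetti.map g (2 * 1) κJ) (complexBetti.map g (2 * 1) κK) = 0) ∧
            complexBetti.map g (2 * 1) κI = ω') ∧
          C.ch (X ⊗ Y) ((AlgebraicGeometry.Scheme.Modules.pullback (X ◁ g).left).obj 𝓔) 1 = 0 ∧
          (∃ m : ℂ, m ≠ 0 ∧ ∀ y : complexBetti Y (2 * 1),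
            complexBetti.map g (2 * 1)
              (complexGysin μ (IsSmoothProjective.tensor_holds hX.1 hMv) hMv
                (SemiCartesianMonoidalCategory.snd X Mv)
                (by omega : 2 * 3 + 2 * k = 2 * 1 + 2 * (2 + k))
                (cupProduct (rfl : 2 * 1 + 2 * 2 = 2 * 3)
                  (complexBetti.map (SemiCartesianMonoidalCategory.fst X Mv) (2 * 1) (Ψ y))
                  (C.ch (X ⊗ Mv) 𝓔 2))) =
            (-(2 * m)) • y) := by
  sorry

example : Statement.stub_modularTwinAddress = type_of% stub_modularTwinAddress := rfl

/-- **Trianalytic restriction (L; Verbitsky's invariant-class criterion + restriction of a hyperholomorphic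
connection to a trianalytic product submanifold).**  `X, Mv, Y` smooth projective (`dim Y = 2`), `𝓔` a
vector bundle on `X ⊗ Mv` hyperholomorphic for a hyperkähler structure on `(X ⊗ Mv)^an` with decomposed
classes `ω ⊞ κ_I` (Kähler), `α_J ⊞ κ_J`, `α_K ⊞ κ_K`; `g : Y ⟶ Mv` a closed immersion whose restricted
classes have cup matrix `c·𝟙`, `c > 0` (so `∫_{g(Y)} ω_L²` is the same for every induced `L`: by
Wirtinger `g(Y)` is complex for every `L`, i.e. trianalytic, and `T(X × g(Y))` is quaternionic).  THEN the
restriction `(X ◁ g)^*𝓔` is a vector bundle whose analytification carries a hyperholomorphic Chern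
connection for a hyperkähler structure on `(X ⊗ Y)^an` with Kähler class `ω ⊞ g^*κ_I` (the induced
structure).  [cite: Verbitsky1996Hyperholomorphic, Def. 2.1] [difficulty: L] -/
def Statement.stub_trianalyticRestriction : Prop :=
  ∀ (a k : ℕ) (X Mv Y : SchemeOver ℂ) (hX : IsSmoothProjective a X) (hMv : IsSmoothProjective k Mv)
      (hY : IsSmoothProjective 2 Y) (pY : complexBetti Y (2 * 2)),
      (IsIntegralClass pY ∧ ∀ q : complexBetti Y (2 * 2), IsIntegralClass q → ∃ n : ℤ, q = n • pY) →
    ∀ (𝓔 : (X ⊗ Mv).left.Modules) (rk : ℕ) (g : Y ⟶ Mv) (ωX αJ αK : complexBetti X (2 * 1))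
      (κI κJ κK : complexBetti Mv (2 * 1)) (c : ℝ),
      IsVectorBundle 𝓔 → AlgebraicGeometry.IsClosedImmersion g.left → 0 < c →
      (∃ (A : HodgeModel (a + k) (X ⊗ Mv))
        (𝓕 : AnalytifiedVectorBundle 𝓘(ℂ, A.model) (EuclideanSpace ℂ (Fin rk)) A.toComplexPoints 𝓔)
        (gm : Bundle.ContMDiffRiemannianMetric 𝓘(ℝ, A.model) ∞ A.model
          (fun x : A.carrier ↦ TangentSpace 𝓘(ℝ, A.model) x))
        (J K : ∀ x : A.carrier, TangentSpace 𝓘(ℝ, A.model) x →L[ℝ] TangentSpace 𝓘(ℝ, A.model) x)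
        (hHK : IsHyperkaehlerTriple gm.toRiemannianMetric J K)
        (hω : isSmoothForm_kaehlerForm_of_isManifold_complex (E := A.model) (M := A.carrier))
        (e : DeRhamIsoFamily 𝓘(ℝ, A.model)),
        e.IsNatural ∧
        A.pullback 2
            (complexBetti.map (SemiCartesianMonoidalCategory.fst X Mv) (2 * 1) (ωX) +
              complexBetti.map (SemiCartesianMonoidalCategory.snd X Mv) (2 * 1) κI) =
          ofRealClass A.carrier 2 (e A.carrier 2 (gm.kaehlerClass hω hHK.isKaehler)) ∧
        A.pullback 2
            (complexBetti.map (SemiCartesianMonoidalCategory.fst X Mv) (2 * 1) αJ +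
              complexBetti.map (SemiCartesianMonoidalCategory.snd X Mv) (2 * 1) κJ) =
          ofRealClass A.carrier 2 (e A.carrier 2 (deRhamCohomology.mk
            ⟨twoFormOf gm.toRiemannianMetric J, hHK.isSmoothForm_J, hHK.isClosedForm_J⟩)) ∧
        A.pullback 2
            (complexBetti.map (SemiCartesianMonoidalCategory.fst X Mv) (2 * 1) αK +
              complexBetti.map (SemiCartesianMonoidalCategory.snd X Mv) (2 * 1) κK) =
          ofRealClass A.carrier 2 (e A.carrier 2 (deRhamCohomology.mk
            ⟨twoFormOf gm.toRiemannianMetric K, hHK.isSmoothForm_K, hHK.isClosedForm_K⟩)) ∧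
        HasHyperholomorphicConnection (EuclideanSpace ℂ (Fin rk)) 𝓕.bundle J K) →
      (cupProduct (rfl : 2 * 1 + 2 * 1 = 2 * 2) (complexBetti.map g (2 * 1) κI) (complexBetti.map g (2 * 1) κI) = ((c : ℝ) : ℂ) • pY ∧
      cupProduct (rfl : 2 * 1 + 2 * 1 = 2 * 2) (complexBetti.map g (2 * 1) κJ) (complexBetti.map g (2 * 1) κJ) = ((c : ℝ) : ℂ) • pY ∧
      cupProduct (rfl : 2 * 1 + 2 * 1 = 2 * 2) (complexBetti.map g (2 * 1) κK) (complexBetti.map g (2 * 1) κK) = ((c : ℝ) : ℂ) • pY ∧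
      cupProduct (rfl : 2 * 1 + 2 * 1 = 2 * 2) (complexBetti.map g (2 * 1) κI) (complexBetti.map g (2 * 1) κJ) = 0 ∧
      cupProduct (rfl : 2 * 1 + 2 * 1 = 2 * 2) (complexBetti.map g (2 * 1) κI) (complexBetti.map g (2 * 1) κK) = 0 ∧
      cupProduct (rfl : 2 * 1 + 2 * 1 = 2 * 2) (complexBetti.map g (2 * 1) κJ) (complexBetti.map g (2 * 1) κK) = 0) →
      IsVectorBundle ((AlgebraicGeometry.Scheme.Modules.pullback (X ◁ g).left).obj 𝓔) ∧
      ∃ (A : HodgeModel (a + 2) (X ⊗ Y))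
        (𝓕 : AnalytifiedVectorBundle 𝓘(ℂ, A.model) (EuclideanSpace ℂ (Fin rk)) A.toComplexPoints
          ((AlgebraicGeometry.Scheme.Modules.pullback (X ◁ g).left).obj 𝓔))
        (gm : Bundle.ContMDiffRiemannianMetric 𝓘(ℝ, A.model) ∞ A.model
          (fun x : A.carrier ↦ TangentSpace 𝓘(ℝ, A.model) x))
        (J K : ∀ x : A.carrier, TangentSpace 𝓘(ℝ, A.model) x →L[ℝ] TangentSpace 𝓘(ℝ, A.model) x)
        (hHK : IsHyperkaehlerTriple gm.toRiemannianMetric J K)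
        (hω : isSmoothForm_kaehlerForm_of_isManifold_complex (E := A.model) (M := A.carrier))
        (e : DeRhamIsoFamily 𝓘(ℝ, A.model)),
        e.IsNatural ∧
        A.pullback 2
            (complexBetti.map (SemiCartesianMonoidalCategory.fst X Y) (2 * 1) (ωX) +
              complexBetti.map (SemiCartesianMonoidalCategory.snd X Y) (2 * 1) (complexBetti.map g (2 * 1) κI)) =
          ofRealClass A.carrier 2 (e A.carrier 2 (gm.kaehlerClass hω hHK.isKaehler)) ∧
        HasHyperholomorphicConnection (EuclideanSpace ℂ (Fin rk)) 𝓕.bundle J K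

theorem stub_trianalyticRestriction :
    ∀ (a k : ℕ) (X Mv Y : SchemeOver ℂ) (hX : IsSmoothProjective a X) (hMv : IsSmoothProjective k Mv)
        (hY : IsSmoothProjective 2 Y) (pY : complexBetti Y (2 * 2)),
        (IsIntegralClass pY ∧ ∀ q : complexBetti Y (2 * 2), IsIntegralClass q → ∃ n : ℤ, q = n • pY) →
      ∀ (𝓔 : (X ⊗ Mv).left.Modules) (rk : ℕ) (g : Y ⟶ Mv) (ωX αJ αK : complexBetti X (2 * 1))
        (κI κJ κK : complexBetti Mv (2 * 1)) (c : ℝ),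
        IsVectorBundle 𝓔 → AlgebraicGeometry.IsClosedImmersion g.left → 0 < c →
        (∃ (A : HodgeModel (a + k) (X ⊗ Mv))
          (𝓕 : AnalytifiedVectorBundle 𝓘(ℂ, A.model) (EuclideanSpace ℂ (Fin rk)) A.toComplexPoints 𝓔)
          (gm : Bundle.ContMDiffRiemannianMetric 𝓘(ℝ, A.model) ∞ A.model
            (fun x : A.carrier ↦ TangentSpace 𝓘(ℝ, A.model) x))
          (J K : ∀ x : A.carrier, TangentSpace 𝓘(ℝ, A.model) x →L[ℝ] TangentSpace 𝓘(ℝ, A.model) x)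
          (hHK : IsHyperkaehlerTriple gm.toRiemannianMetric J K)
          (hω : isSmoothForm_kaehlerForm_of_isManifold_complex (E := A.model) (M := A.carrier))
          (e : DeRhamIsoFamily 𝓘(ℝ, A.model)),
          e.IsNatural ∧
          A.pullback 2
              (complexBetti.map (SemiCartesianMonoidalCategory.fst X Mv) (2 * 1) (ωX) +
                complexBetti.map (SemiCartesianMonoidalCategory.snd X Mv) (2 * 1) κI) =
            ofRealClass A.carrier 2 (e A.carrier 2 (gm.kaehlerClass hω hHK.isKaehler)) ∧
          A.pullback 2
              (complexBetti.map (SemiCartesianMonoidalCategory.fst X Mv) (2 * 1) αJ +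
                complexBetti.map (SemiCartesianMonoidalCategory.snd X Mv) (2 * 1) κJ) =
            ofRealClass A.carrier 2 (e A.carrier 2 (deRhamCohomology.mk
              ⟨twoFormOf gm.toRiemannianMetric J, hHK.isSmoothForm_J, hHK.isClosedForm_J⟩)) ∧
          A.pullback 2
              (complexBetti.map (SemiCartesianMonoidalCategory.fst X Mv) (2 * 1) αK +
                complexBetti.map (SemiCartesianMonoidalCategory.snd X Mv) (2 * 1) κK) =
            ofRealClass A.carrier 2 (e A.carrier 2 (deRhamCohomology.mk
              ⟨twoFormOf gm.toRiemannianMetric K, hHK.isSmoothForm_K, hHK.isClosedForm_K⟩)) ∧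
          HasHyperholomorphicConnection (EuclideanSpace ℂ (Fin rk)) 𝓕.bundle J K) →
        (cupProduct (rfl : 2 * 1 + 2 * 1 = 2 * 2) (complexBetti.map g (2 * 1) κI) (complexBetti.map g (2 * 1) κI) = ((c : ℝ) : ℂ) • pY ∧
        cupProduct (rfl : 2 * 1 + 2 * 1 = 2 * 2) (complexBetti.map g (2 * 1) κJ) (complexBetti.map g (2 * 1) κJ) = ((c : ℝ) : ℂ) • pY ∧
        cupProduct (rfl : 2 * 1 + 2 * 1 = 2 * 2) (complexBetti.map g (2 * 1) κK) (complexBetti.map g (2 * 1) κK) = ((c : ℝ) : ℂ) • pY ∧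
        cupProduct (rfl : 2 * 1 + 2 * 1 = 2 * 2) (complexBetti.map g (2 * 1) κI) (complexBetti.map g (2 * 1) κJ) = 0 ∧
        cupProduct (rfl : 2 * 1 + 2 * 1 = 2 * 2) (complexBetti.map g (2 * 1) κI) (complexBetti.map g (2 * 1) κK) = 0 ∧
        cupProduct (rfl : 2 * 1 + 2 * 1 = 2 * 2) (complexBetti.map g (2 * 1) κJ) (complexBetti.map g (2 * 1) κK) = 0) →
        IsVectorBundle ((AlgebraicGeometry.Scheme.Modules.pullback (X ◁ g).left).obj 𝓔) ∧
        ∃ (A : HodgeModel (a + 2) (X ⊗ Y))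
          (𝓕 : AnalytifiedVectorBundle 𝓘(ℂ, A.model) (EuclideanSpace ℂ (Fin rk)) A.toComplexPoints
            ((AlgebraicGeometry.Scheme.Modules.pullback (X ◁ g).left).obj 𝓔))
          (gm : Bundle.ContMDiffRiemannianMetric 𝓘(ℝ, A.model) ∞ A.model
            (fun x : A.carrier ↦ TangentSpace 𝓘(ℝ, A.model) x))
          (J K : ∀ x : A.carrier, TangentSpace 𝓘(ℝ, A.model) x →L[ℝ] TangentSpace 𝓘(ℝ, A.model) x)
          (hHK : IsHyperkaehlerTriple gm.toRiemannianMetric J K)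
          (hω : isSmoothForm_kaehlerForm_of_isManifold_complex (E := A.model) (M := A.carrier))
          (e : DeRhamIsoFamily 𝓘(ℝ, A.model)),
          e.IsNatural ∧
          A.pullback 2
              (complexBetti.map (SemiCartesianMonoidalCategory.fst X Y) (2 * 1) (ωX) +
                complexBetti.map (SemiCartesianMonoidalCategory.snd X Y) (2 * 1) (complexBetti.map g (2 * 1) κI)) =
            ofRealClass A.carrier 2 (e A.carrier 2 (gm.kaehlerClass hω hHK.isKaehler)) ∧
          HasHyperholomorphicConnection (EuclideanSpace ℂ (Fin rk)) 𝓕.bundle J K := by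
  sorry

example : Statement.stub_trianalyticRestriction = type_of% stub_trianalyticRestriction := rfl

/-- **Mixed-class transfer (M; the class computation).**  `θ x := snd_*(fst^* x ∪ ch₂ 𝓔)` (Mukai's map
`H²(X) → H²(Mv)`); the action of `ch₂` of the restriction `(X ◁ g)^*𝓔` on `H²(Y)` is the cup-adjoint of
`g^* ∘ θ` (Künneth: only the `(2,2)` component is seen; base change `(X ◁ g)`/`snd`, projection formula for
`g`, `ch₂ ∘ pullback = pullback ∘ ch₂`).  With the address equation `g^*θΨ = −2m` and `(Ψu.Ψw) = 2(u.w)`,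
`Ψ` bijective: `b_X([ch₂]_* y, Ψw) = u(−2m)(y.w) = −u·m·b_X(Ψy, Ψw)`, so `[ch₂]_* = −m′Ψ` with `m′ = u·m`, `u ∈ ℂˣ`
the unit relating the Gysin scalars of `snd : X ⊗ Mv → Mv` and `fst : X ⊗ Y → X` for the family `μ` (v3: `m, m′ : ℂ`;
with a rationally normalised `μ`, `m′ = ±m`).  GRANTED the Künneth spanning property (hypothesis `hK`, verbatim that of
`gysin_baseChange_of_kunneth`; registered separately as `stub_kunnethSpanning`): base change for the square
`X ⊗ Y → X ⊗ Mv` over `g` and the transpose identity `⟨[κ']_* y ∪ x, [X]⟩ = u ⟨y ∪ [κ']^* x, [Y]⟩` are proved from it as in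
`GysinBaseChangeOfKunneth`.  [folklore] [difficulty: M] -/
def Statement.stub_mixedClassTransfer : Prop :=
  ∀ (μ : OrientationFamily), μ.HasPoincareDuality →
    (∀ ⦃m' n' : ℕ⦄ ⦃Y' Z' : SchemeOver ℂ⦄, IsSmoothProjective m' Y' → IsSmoothProjective n' Z' →
      ∀ (k : ℕ) (z : complexBetti (Y' ⊗ Z') k), z ∈ Submodule.span ℂ
        {v | ∃ (i j : ℕ) (h : i + j = k) (b : complexBetti Y' i) (w : complexBetti Z' j),
          v = cupProduct h (complexBetti.map (SemiCartesianMonoidalCategory.fst Y' Z') i b)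
            (complexBetti.map (SemiCartesianMonoidalCategory.snd Y' Z') j w)}) →
    ∀ (C : ChernCharacterBetti) (k : ℕ) (X Y Mv : SchemeOver ℂ) (hX : IsSmoothProjective 2 X)
      (hY : IsSmoothProjective 2 Y) (hMv : IsSmoothProjective k Mv)
      (pX : complexBetti X (2 * 2)) (pY : complexBetti Y (2 * 2)),
      (IsIntegralClass pX ∧ ∀ q : complexBetti X (2 * 2), IsIntegralClass q → ∃ n : ℤ, q = n • pX) →
      (IsIntegralClass pY ∧ ∀ q : complexBetti Y (2 * 2), IsIntegralClass q → ∃ n : ℤ, q = n • pY) →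
    ∀ (Ψ : complexBetti Y (2 * 1) →ₗ[ℂ] complexBetti X (2 * 1)),
      (∀ (x y : complexBetti Y (2 * 1)) (a : ℂ),
        cupProduct (rfl : 2 * 1 + 2 * 1 = 2 * 2) x y = a • pY →
        cupProduct (rfl : 2 * 1 + 2 * 1 = 2 * 2) (Ψ x) (Ψ y) = ((2 : ℂ) * a) • pX) →
      Function.Bijective Ψ →
    ∀ (𝓔 : (X ⊗ Mv).left.Modules) (g : Y ⟶ Mv) (m : ℂ), IsVectorBundle 𝓔 → m ≠ 0 →
      (∀ y : complexBetti Y (2 * 1),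
          complexBetti.map g (2 * 1)
            (complexGysin μ (IsSmoothProjective.tensor_holds hX hMv) hMv
              (SemiCartesianMonoidalCategory.snd X Mv)
              (by omega : 2 * 3 + 2 * k = 2 * 1 + 2 * (2 + k))
              (cupProduct (rfl : 2 * 1 + 2 * 2 = 2 * 3)
                (complexBetti.map (SemiCartesianMonoidalCategory.fst X Mv) (2 * 1) (Ψ y))
                (C.ch (X ⊗ Mv) 𝓔 2))) =
          (-(2 * m)) • y) →
      ∃ m' : ℂ, m' ≠ 0 ∧ ∀ y : complexBetti Y (2 * 1),
          complexGysin μ (IsSmoothProjective.tensor_holds hX hY) hX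
            (SemiCartesianMonoidalCategory.fst X Y)
            (rfl : 2 * 1 + 2 * 2 + 2 * 2 = 2 * 1 + 2 * (2 + 2))
            (cupProduct (rfl : 2 * 1 + 2 * 2 = 2 * 1 + 2 * 2)
              (complexBetti.map (SemiCartesianMonoidalCategory.snd X Y) (2 * 1) y)
              (C.ch (X ⊗ Y) ((AlgebraicGeometry.Scheme.Modules.pullback (X ◁ g).left).obj 𝓔) 2)) =
          (-m') • Ψ y

-- `theorem stub_mixedClassTransfer` — LANDED (wave 1, p81390):
-- `Summits/HodgeConjecture/HodgeConjecture/Theorems/NikulinTwinTransportNikulinSerreCarrierMixedClassTransfer.lean`, imported above;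
-- the registered statement is kept as `Statement.stub_mixedClassTransfer` and certified identical below.

example : Statement.stub_mixedClassTransfer = type_of% stub_mixedClassTransfer := rfl

/-- **Künneth spanning (formal debt; a theorem).**  Every class on the complex points of a product
`Y' ⊗ Z'` of smooth projective varieties is a `ℂ`-linear combination of cross products `fst^* b ∪ snd^* w`
(the spanning half of the Künneth formula for `H*((Y' ⊗ Z')(ℂ); ℂ) = H*(Y'(ℂ) × Z'(ℂ); ℂ)` with field
coefficients).  Verbatim the hypothesis `hK` under which the tree proves Gysin base change
(`Literature.AlgebraicGeometry.HodgeTheory.gysin_baseChange_of_kunneth`); `stub_mixedClassTransfer` consumes it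
(base change for the square `X ⊗ Y → X ⊗ Mv` over `g`, and the transpose of a correspondence).
[cite: HatcherAT2002, §3.2 Thm. 3.15, Thm. 3.16 and Cor. A.12] [difficulty: L, formal] -/
def Statement.stub_kunnethSpanning : Prop :=
  ∀ ⦃m' n' : ℕ⦄ ⦃Y' Z' : SchemeOver ℂ⦄, IsSmoothProjective m' Y' → IsSmoothProjective n' Z' →
    ∀ (k : ℕ) (z : complexBetti (Y' ⊗ Z') k), z ∈ Submodule.span ℂ
      {v | ∃ (i j : ℕ) (h : i + j = k) (b : complexBetti Y' i) (w : complexBetti Z' j),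
        v = cupProduct h (complexBetti.map (SemiCartesianMonoidalCategory.fst Y' Z') i b)
          (complexBetti.map (SemiCartesianMonoidalCategory.snd Y' Z') j w)}

theorem stub_kunnethSpanning :
    ∀ ⦃m' n' : ℕ⦄ ⦃Y' Z' : SchemeOver ℂ⦄, IsSmoothProjective m' Y' → IsSmoothProjective n' Z' →
      ∀ (k : ℕ) (z : complexBetti (Y' ⊗ Z') k), z ∈ Submodule.span ℂ
        {v | ∃ (i j : ℕ) (h : i + j = k) (b : complexBetti Y' i) (w : complexBetti Z' j),
          v = cupProduct h (complexBetti.map (SemiCartesianMonoidalCategory.fst Y' Z') i b)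
            (complexBetti.map (SemiCartesianMonoidalCategory.snd Y' Z') j w)} := by
  sorry

example : Statement.stub_kunnethSpanning = type_of% stub_kunnethSpanning := rfl

/-! ## The composition: the three remaining stubs (+ the landed `stub_mixedClassTransfer`) imply the typed crux
(kernel-checked, no `sorry`). -/

/-- **`modular-twin-address` closes K1.**  Address (stub 1) ⇒ restrict along the trianalytic twin (stub 2)
⇒ transfer the mixed class (stub 3, granted Künneth spanning = stub 4) ⇒ the carrier `G := (X ◁ g)^*𝓔` on `X ⊗ Y` with `ch₁ = 0`,
`[ch₂]_* = −m′Ψ`, hyperholomorphic for a hyperkähler structure of Kähler class `Ψω′ ⊞ ω′`. -/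
theorem NikulinSerreCarrier_of
    (h₁ : Statement.stub_modularTwinAddress)
    (h₂ : Statement.stub_trianalyticRestriction)
    (h₄ : Statement.stub_kunnethSpanning) :
    Summit.HodgeConjecture.HodgeConjecture.Cruxes.NikulinSerreCarrier.NikulinSerreCarrier := by
  intro μ hμ C
  obtain ⟨X, Y, hX, hY, pX, pY, ι, N, h, r, Ψ, hι, hpX, hpY, hN, hNN, heven, hh, hhN, hhh, hr, hrr, hΨrat,
      hΨhodge, hΨsim, hΨbij, hΨN, hΨinv, hΨalg, ε, hε, ω', hω', k, Mv, hMv, 𝓔, rk, g, hE, hg,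
      ⟨κI, κJ, κK, αJ, αK, c, hc, hpkg, hcup, hframe⟩, hc1, m, hm, haddr⟩ := h₁ μ hμ C
  obtain ⟨hGvb, A, 𝓕, gm, J, K, hHK, hω, e, he, hkc, hhyp⟩ :=
    h₂ 2 k X Mv Y hX.1 hMv hY.1 pY hpY 𝓔 rk g (Ψ ω') αJ αK κI κJ κK c hE hg hc hpkg hcup
  obtain ⟨m', hm', hact⟩ :=
    stub_mixedClassTransfer μ hμ h₄ C k X Y Mv hX.1 hY.1 hMv pX pY hpX hpY Ψ hΨsim hΨbij 𝓔 g m hE hm haddr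
  rw [hframe] at hkc
  exact ⟨X, Y, hX, hY, pX, pY, ι, N, h, r, Ψ, hι, hpX, hpY, hN, hNN, heven, hh, hhN, hhh, hr, hrr, hΨrat,
    hΨhodge, hΨsim, hΨbij, hΨN, hΨinv, hΨalg, ε, hε, ω', hω', _, rk, hGvb, hc1, ⟨m', hm', hact⟩, A, 𝓕, gm,
    J, K, hHK, hω, e, he, hkc, hhyp⟩

end Summit.HodgeConjecture.HodgeConjecture.Cruxes.NikulinSerreCarrier.ModularTwinAddress
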